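import Summits.HodgeConjecture.HodgeConjecture.Theorems.WeilTypeLadderBlochSeed
import Literature.AlgebraicGeometry.HodgeTheory.WeilClassesBFSheafSeed
import HarnessLib

/-!
# Venture HSemireg — SHEAF representatives: a Buchweitz–Flenner `I`-semiregular vector bundle at ONE anchor and the
# transfer «BF Thm. 5.1 ∧ one sheaf seed ⟹ the local variational clause ⟹ the anchor's whole Weil-type component»

HONEST FRAMING. Lean index of the computation cell `pub-hsemireg`; nothing about any explicit variety is asserted. The
coordinator's STEP-0 allows the semiregular representative at the CM point to be "an algebraic cycle OR a sheaf/complex".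
`Statement.lean` indexes the CYCLE door (Bloch 1972: an integral Bloch-semiregular local complete intersection,
`HasBlochSeedAt`, transport fact `BlochSemiregularSpread`). This file indexes the SHEAF door with the tree's REFEREED
transport fact `BuchweitzFlenner2003_variationalHodge_ISemiregular` ([BuchweitzFlenner2003, Thm. 5.1] for a finite set `I`
of Chern degrees, finite locally free `ℰ₀`; `Literature/…/SemiregularVariationalHodgeISemiregular.lean`) and the tree's REAL
partial semiregularity map `σ_I = (σ_q)_{q+1 ∈ I} : Ext²(ℰ₀, ℰ₀) → ∏ H^{q+2}(X, Ω^q)` (`IsISemiregular`,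
`SemiregularityHigherSigma.lean`: Mathlib's `Ext` in `X.Modules`, the tree's Atiyah class and traces).

* `HasBFSheafSeedAt C n I P h w` (PREDICATE, single anchor; the tree's `HasTensorBFSheafSeeds C k p I` is the ∀-tensor-point
  form): on EVERY model `e : P.X ≅ X₀` of the anchor there are a finite locally free `ℰ₀` on `X₀`, `q ∈ ℚ`, `c : ℕ → ℚ` with
  `n ∈ I`, `ℰ₀` `I`-semiregular, `e^* ch_n(ℰ₀) = q·hⁿ + w` and `e^* ch_p(ℰ₀) = c_p·hᵖ` for the other `p ∈ I` (so that every
  `ch_p`, `p ∈ I`, is met by a GLOBAL class of any family carrying `h`: the hypothesis "`(α_p)_{p∈I}` horizontal" of Thm. 5.1).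
  Parametrised by a Chern character theory `C : ChernCharacterBetti`, as every consumer of the tree's BF facts. For a
  fourfold (`n = 2`) with `I = {1, 2}` the semiregularity clause is injectivity of `(σ_0, σ_1) = (Tr, Tr(At ∘ ·))` on
  `Ext²(ℰ₀, ℰ₀)` — Markman's / Mukai's setting; for a sixfold `I ∋ 3` needs `σ_2` as well.
* `weilAnchorLocalClause_of_BF_of_sheafSeedAt` (PROVED, ~ the tree's `hasLocallyAlgebraicTensorAnchors_of_BF_of_tensorBFSheafSeeds`
  at one anchor): **`BuchweitzFlenner2003_variationalHodge_ISemiregular ∧ HasBFSheafSeedAt C n I P h w ⟹ WeilAnchorLocalClause n d P h w`**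
  (every `d`). Proof: along a family of the clause with global `H`, `W` and chart `e₀ : P ≅ 𝒳_{s₀}`, the seed on the model
  `e₀` gives `ℰ₀` on `𝒳_{s₀}` with `ch_n(ℰ₀) = (q·Hⁿ + W)|_{s₀}`, `ch_p(ℰ₀) = c_p·Hᵖ|_{s₀}`; `Rⁱf_*ℂ` is a local system on
  `S(ℂ)` (Ehresmann, proved in the tree) and restrictions of global classes are flat, so all transports are of type `(p,p)`;
  Thm. 5.1 gives an open `W' ∋ s₀` with algebraic transports along paths in `W'`; conclude on the path component of `s₀`.
* `weilClasses_algebraic_of_similar_sheafSeed`, `weilClasses_algebraic_split_of_hyperbolic_sheafSeed`: the same two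
  named cases as in `Statement.lean` (the anchor's component by `weilFamilyReach_similar`; the split component by
  `weilFamilyReach_hyperbolic`), now from ONE `I`-semiregular vector bundle. All transport/reach inputs REFEREED named
  facts BY NAME; the seed is the cell's computed object; nothing asserted.

What is NOT here: coherent / reflexive / perfect-complex seeds (Markman's secant sheaves are reflexive, not locally
free; BF Thm. 5.1 for modules and Pridham 2024 are not rendered on real carriers — the tree's only door for them is the
UNREFEREED `Perry2026_…`/`Markman2025_…` facts); twisted (`B`-field) seeds (`WeilTypeLadderQuadraticVariationalEngineTwisted`).

References: [BuchweitzFlenner2003] R.-O. Buchweitz, H. Flenner, Compositio Math. 137 (2003), §5 Thm. 5.1 and the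
definition of `I`-semiregular; [Deligne1982HodgeCycles] P. Deligne, LNM 900, proof of Thm. 4.8; [VoisinHodgeI2002] §9.2.1,
Thm. 9.3 (Ehresmann); [Markman2025SecantWeil] arXiv:2502.03415, §1.5 (shape `q·hⁿ + w`).
-/

noncomputable section

open CategoryTheory AlgebraicGeometry
open _root_.Topology _root_.Filter

namespace Summit.Ventures.HSemireg

open Literature.AlgebraicGeometry Literature.AlgebraicGeometry.Motives
open Literature.AlgebraicGeometry.HodgeTheory
open Literature.AlgebraicTopology.SingularHomology
open Summit.HodgeConjecture.HodgeConjecture.WeilTypeLadder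

/-! ## The single-anchor sheaf seed -/

/-- **A Buchweitz–Flenner sheaf seed for `q·hⁿ + w` on the abelian variety `P`, Chern degrees `I`** (PREDICATE, nothing
asserted; a DESIGN input). For every model `e : P.X ≅ X₀` of the anchor: a finite locally free `ℰ₀` on `X₀`, `q ∈ ℚ` and
`c : ℕ → ℚ` with `n ∈ I`, `ℰ₀` `I`-semiregular ("the part `σ_I : Ext²(ℰ₀, ℰ₀) → ∏_{p ∈ I} H^{p+1}(X₀, Ω^{p−1})` of the
semiregularity map is injective", in the tree's form-degree numbering `IsISemiregular hℰ₀ {q' | q' + 1 ∈ I}`),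
`e^* ch_n(ℰ₀) = q·hⁿ + w` and `e^* ch_p(ℰ₀) = c_p·hᵖ` for `p ∈ I`, `p ≠ n`. Single-anchor form of the tree's
`HasTensorBFSheafSeeds` (which asks this at EVERY tensor point for EVERY hyperplane-type `h`); the "every model" quantifier
makes the seed consumable on the fibre of any family through `P` (an honest construction transports along isomorphisms).
[cite: BuchweitzFlenner2003, §5 Thm. 5.1 (hypotheses) and §5 (I-semiregular)] [cite: Markman2025SecantWeil, §1.5] -/
def HasBFSheafSeedAt (C : ChernCharacterBetti) (n : ℕ) (I : Finset ℕ) (P : AbelianVariety ℂ)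
    (h : complexBetti P.X 2) (w : complexBetti P.X (2 * n)) : Prop :=
  ∀ (X₀ : SchemeOver ℂ) (e : P.X ≅ X₀),
    ∃ (E₀ : X₀.left.Modules) (hE₀ : IsFiniteLocallyFree E₀) (q : ℚ) (c : ℕ → ℚ),
      n ∈ I ∧ IsISemiregular hE₀ {q' | q' + 1 ∈ I} ∧
      complexBetti.map e.hom (2 * n) (C.ch X₀ E₀ n) = ((q : ℚ) : ℂ) • cupPowTwo h n + w ∧
      ∀ p ∈ I, p ≠ n → complexBetti.map e.hom (2 * p) (C.ch X₀ E₀ p) = ((c p : ℚ) : ℂ) • cupPowTwo h p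

/-! ## BF Thm. 5.1 ∧ one sheaf seed ⟹ the local clause at the anchor -/

/-- **The local variational clause from ONE `I`-semiregular vector bundle.** Granting the refereed fact
`BuchweitzFlenner2003_variationalHodge_ISemiregular` (BF Thm. 5.1, general finite `I`), a sheaf seed for `q·hⁿ + w` on `P`
gives `WeilAnchorLocalClause n d P h w` for every `d`: along every smooth projective family of `√-d`-Weil abelian `2n`-folds
through `P` carrying `h`, `w` as global classes `H`, `W`, the class `q·Hⁿ + W` is algebraic on all fibres over an open
neighbourhood of the anchor. (The clause's hypothesis "fibres abelian with an endomorphism of square `-d`" is not used.)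
[cite: BuchweitzFlenner2003, §5 Thm. 5.1] [cite: VoisinHodgeI2002, §9.2.1 and Thm. 9.3] -/
theorem weilAnchorLocalClause_of_BF_of_sheafSeedAt {n : ℕ} (d : ℕ) (C : ChernCharacterBetti) {I : Finset ℕ}
    (hBF : BuchweitzFlenner2003_variationalHodge_ISemiregular) {P : AbelianVariety ℂ} {h : complexBetti P.X 2}
    {w : complexBetti P.X (2 * n)} (hS : HasBFSheafSeedAt C n I P h w) : WeilAnchorLocalClause n d P h w := by
  intro 𝒳 S f hf _ hSqp hSirr hsm _ H W hH hW s₀ e₀ hH₀ hW₀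
  -- (1) `Rⁱf_*ℂ` is a local system on all of `S(ℂ)`, a path connected, locally path connected manifold
  haveI := hSirr
  haveI := hsm
  haveI : LocallyOfFiniteType S.hom := hSqp.locallyOfFiniteType
  haveI : ConnectedSpace (ComplexPoints S) := (ComplexPoints.connectedSpace_iff_holds S).2 inferInstance
  obtain ⟨dS, hd⟩ := exists_smoothOfRelativeDimension_of_connectedSpace_complexPoints S
  haveI := hd
  haveI := pathConnectedSpace_complexPoints_of_smoothOfRelativeDimension S dS
  have hU : IsCohomologicallyLocallyTrivialOn f (Set.univ : Set (ComplexPoints S)) :=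
    isCohomologicallyLocallyTrivialOn_univ_of_isSmoothProjectiveFamily f dS hf hSqp
  letI := ComplexPoints.chartedSpace S dS
  haveI : LocallyPathConnectedSpace (ComplexPoints S) :=
    ChartedSpace.locallyPathConnectedSpace (EuclideanSpace ℝ (Fin (2 * dS))) (ComplexPoints S)
  let s₀' : (Set.univ : Set (ComplexPoints S)) := ⟨s₀, Set.mem_univ s₀⟩
  -- (2) the sheaf seed on the model `e₀ : P ≅ 𝒳_{s₀}`
  obtain ⟨E₀, hE₀, q, c, hnI, hsr, hchn, hchp⟩ := hS (fiberOver f s₀) e₀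
  -- the global class `B := q·Hⁿ + W` and its fibre restrictions
  set Bcl : complexBetti 𝒳 (2 * n) := ((q : ℚ) : ℂ) • cupPowTwo H n + W with hBdef
  have hres : ∀ s : ComplexPoints S, complexBetti.map (fiberι f s) (2 * n) Bcl =
      ((q : ℚ) : ℂ) • cupPowTwo (complexBetti.map (fiberι f s) 2 H) n + complexBetti.map (fiberι f s) (2 * n) W := by
    intro s
    rw [hBdef, map_add, map_smul, complexBetti_map_cupPowTwo']
  have hBrat : ∀ s : ComplexPoints S,
      IsOfHodgeType (2 * n) (fiberOver f s) (2 * n) n n (complexBetti.map (fiberι f s) (2 * n) Bcl) := by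
    intro s
    rw [hres]
    exact ((isOfHodgeType_cupPowTwo (hf.isSmoothProjective s) (hH s).2 n).smul _).add (hf.isSmoothProjective s) (hW s).2
  have hHp₀ : ∀ p : ℕ, complexBetti.map e₀.hom (2 * p) (complexBetti.map (fiberι f s₀) (2 * p) (cupPowTwo H p)) =
      cupPowTwo h p := by
    intro p
    rw [complexBetti_map_cupPowTwo', complexBetti_map_cupPowTwo', hH₀]
  -- `ch_n(ℰ₀) = B|_{s₀}` and `ch_p(ℰ₀) = c_p·Hᵖ|_{s₀}` (compare after pulling back by the iso `e₀`)
  have hchn' : C.ch (fiberOver f s₀) E₀ n = complexBetti.map (fiberι f s₀) (2 * n) Bcl := by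
    apply complexBetti.map_injective_of_iso e₀ (2 * n)
    rw [hchn, hres, map_add, map_smul, complexBetti_map_cupPowTwo', hH₀, hW₀]
  have hchp' : ∀ p ∈ I, p ≠ n → C.ch (fiberOver f s₀) E₀ p =
      complexBetti.map (fiberι f s₀) (2 * p) (((c p : ℚ) : ℂ) • cupPowTwo H p) := by
    intro p hp hpn
    apply complexBetti.map_injective_of_iso e₀ (2 * p)
    rw [hchp p hp hpn, map_smul, map_smul, hHp₀ p]
  -- (3) the hypotheses of Thm. 5.1 over `U = S(ℂ)`: all transports of `ch_p(ℰ₀)`, `p ∈ I`, are of type `(p,p)`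
  have hHodge : ∀ p ∈ I, ∀ (t : (Set.univ : Set (ComplexPoints S))) (γ : Path.Homotopic.Quotient s₀' t),
      IsOfHodgeType (2 * n) (fiberOver f t.1) (2 * p) p p
        (transportFun f (2 * p) hU γ (C.ch (fiberOver f s₀'.1) E₀ p)) := by
    intro p hp t γ
    by_cases hpn : p = n
    · subst hpn
      change IsOfHodgeType (2 * p) (fiberOver f t.1) (2 * p) p p (transportFun f (2 * p) hU γ (C.ch (fiberOver f s₀) E₀ p))
      rw [hchn', transportFun_map_fiberι f (2 * p) hU γ Bcl]
      exact hBrat t.1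
    · change IsOfHodgeType (2 * n) (fiberOver f t.1) (2 * p) p p (transportFun f (2 * p) hU γ (C.ch (fiberOver f s₀) E₀ p))
      rw [hchp' p hp hpn, transportFun_map_fiberι f (2 * p) hU γ, map_smul, complexBetti_map_cupPowTwo']
      exact (isOfHodgeType_cupPowTwo (hf.isSmoothProjective t.1) (hH t.1).2 p).smul _
  obtain ⟨W', hWo, hW'₀, hWU, hW'⟩ := hBF C f (2 * n) hf hsm hU s₀' E₀ hE₀ I hsr hHodge
  -- (4) conclude on the path component of `s₀` in `W'`
  refine ⟨pathComponentIn W' s₀, q, hWo.pathComponentIn s₀, mem_pathComponentIn_self hW'₀, fun t ht ↦ ?_⟩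
  have hj : JoinedIn W' s₀ t := ht
  have hpm : ∀ u, hj.somePath u ∈ W' := hj.somePath_mem
  let γ : Path (⟨s₀, hW'₀⟩ : W') ⟨t, pathComponentIn_subset ht⟩ :=
    { toFun := fun u ↦ ⟨hj.somePath u, hpm u⟩
      continuous_toFun := hj.somePath.continuous.subtype_mk _
      source' := Subtype.ext hj.somePath.source
      target' := Subtype.ext hj.somePath.target }
  have hmem := hW' n hnI ⟨t, pathComponentIn_subset ht⟩ ⟦γ⟧
  have htr : transportFun f (2 * n) (hU.mono hWU hWo) ⟦γ⟧ (C.ch (fiberOver f s₀) E₀ n) =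
      complexBetti.map (fiberι f t) (2 * n) Bcl := by
    rw [hchn']
    exact transportFun_map_fiberι f (2 * n) (hU.mono hWU hWo) ⟦γ⟧ Bcl
  change transportFun f (2 * n) (hU.mono hWU hWo) ⟦γ⟧ (C.ch (fiberOver f s₀) E₀ n) ∈ _ at hmem
  rw [htr, hres] at hmem
  exact hmem

/-! ## The named cases from ONE sheaf seed -/

/-- **The anchor's component from one `I`-semiregular vector bundle.** Granting BF Thm. 5.1 (general `I`) and Deligne's
reach-by-similitude (`weilFamilyReach_similar`), both REFEREED named facts: an anchor `(P, ψ₀, ι, a)` of dimension `2n`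
(`n, d ≥ 1`) with a non-zero rational `(n,n)` Weil class `w` and a sheaf seed for `q·h_Kⁿ + w` (`h_K = symmetrisedClass d P ψ₀ ι a`)
makes the Weil plane of every `√-d`-Weil abelian `2n`-fold with a non-zero `(n,n)` Weil class that is Weil-similar to the
anchor ALGEBRAIC. [cite: BuchweitzFlenner2003, §5 Thm. 5.1] [cite: Deligne1982HodgeCycles, proof of Thm. 4.8]
[cite: CharlesSchnell2014Notes, Prop. 11.3.11] -/
theorem weilClasses_algebraic_of_similar_sheafSeed {n d : ℕ} (hn : 1 ≤ n) (hd : 1 ≤ d) (C : ChernCharacterBetti)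
    {I : Finset ℕ} (hBF : BuchweitzFlenner2003_variationalHodge_ISemiregular) (hF : weilFamilyReach_similar)
    (P : AbelianVariety ℂ) (ψ₀ : P ⟶ P) (ι : ProjectiveEmbedding P.X) (a : complexBetti (projectiveSpace ι.n ℂ) 2)
    (w : complexBetti P.X (2 * n)) (hP : P.dim = 2 * n) (hψ : ψ₀ ≫ ψ₀ = -(d • 𝟙 P)) (ha : IsRationalClass a)
    (ha0 : a ≠ 0) (hwW : w ∈ weilClassesOf P ψ₀ n d) (hwr : IsRationalClass w) (hw0 : w ≠ 0)
    (hwH : IsOfHodgeType (2 * n) P.X (2 * n) n n w)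
    (hS : HasBFSheafSeedAt C n I P ((d : ℂ) • complexBetti.map ι.ι 2 a + complexBetti.map ψ₀.hom.hom.hom 2 (complexBetti.map ι.ι 2 a)) w)
    (A : AbelianVariety ℂ) (φ : A ⟶ A) (hA : A.dim = 2 * n) (hφ : φ ≫ φ = -(d • 𝟙 A))
    (hWA : ∃ wA : complexBetti A.X (2 * n),
      wA ∈ weilClassesOf A φ n d ∧ wA ≠ 0 ∧ IsOfHodgeType (2 * n) A.X (2 * n) n n wA)
    (eA : ProjectiveEmbedding A.X) (aA : complexBetti (projectiveSpace eA.n ℂ) 2) (haA : IsRationalClass aA)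
    (haA0 : aA ≠ 0)
    (hsim : IsWeilSimilar n P ψ₀
      ((d : ℂ) • complexBetti.map ι.ι 2 a + complexBetti.map ψ₀.hom.hom.hom 2 (complexBetti.map ι.ι 2 a)) A φ
      ((d : ℂ) • complexBetti.map eA.ι 2 aA + complexBetti.map φ.hom.hom.hom 2 (complexBetti.map eA.ι 2 aA))) :
    weilClassesOf A φ n d ≤ algebraicClasses A.X n :=
  weilClassesOf_le_algebraicClasses_of_reachSimilar_of_similarAnchor hF hn hd A φ hA hφ hWA
    ⟨eA, aA, P, ψ₀, ι, a, w, haA, haA0, hP, hψ, ha, ha0, hwW, hwr, hw0, hwH,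
      weilAnchorLocalClause_of_BF_of_sheafSeedAt d C hBF hS, hsim⟩

/-- **The split component from one `I`-semiregular vector bundle on a SPLIT anchor.** Granting BF Thm. 5.1 (general `I`)
and Deligne's hyperbolic reach (`weilFamilyReach_hyperbolic`), both REFEREED: a hyperbolic anchor `(P, ψ₀, ι, a)` of
dimension `2n` (`n, d ≥ 1`) with a non-zero rational Weil class `w` and a sheaf seed for `q·h_Kⁿ + w` makes the Weil plane
of EVERY split `√-d`-Weil abelian `2n`-fold algebraic. `n = 2`, `I = {1, 2}` (injectivity of `(Tr, Tr(At ∘ ·))` on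
`Ext²(ℰ₀, ℰ₀)`, `ch₂(ℰ₀) = q·h_K² + w`, `ch₁(ℰ₀) = c₁·h_K`): the cell's STEP-0 in its SHEAF form (Markman's fourfold
theorem on the split component via Buchweitz–Flenner at a CM point, refereed inputs only).
[cite: BuchweitzFlenner2003, §5 Thm. 5.1] [cite: Deligne1982HodgeCycles, proof of Thm. 4.8]
[cite: Markman2025SecantWeil, §1.5 and Cor. 1.6.1] -/
theorem weilClasses_algebraic_split_of_hyperbolic_sheafSeed (n d : ℕ) (hn : 1 ≤ n) (hd : 1 ≤ d)
    (C : ChernCharacterBetti) {I : Finset ℕ} (hBF : BuchweitzFlenner2003_variationalHodge_ISemiregular)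
    (hF : weilFamilyReach_hyperbolic)
    (P : AbelianVariety ℂ) (ψ₀ : P ⟶ P) (ι : ProjectiveEmbedding P.X) (a : complexBetti (projectiveSpace ι.n ℂ) 2)
    (w : complexBetti P.X (2 * n)) (hP : P.dim = 2 * n) (hψ : ψ₀ ≫ ψ₀ = -(d • 𝟙 P)) (ha : IsRationalClass a)
    (ha0 : a ≠ 0)
    (hhyp : IsHyperbolicWeilType P ψ₀ n
      ((d : ℂ) • complexBetti.map ι.ι 2 a + complexBetti.map ψ₀.hom.hom.hom 2 (complexBetti.map ι.ι 2 a)))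
    (hwW : w ∈ weilClassesOf P ψ₀ n d) (hwr : IsRationalClass w) (hw0 : w ≠ 0)
    (hS : HasBFSheafSeedAt C n I P ((d : ℂ) • complexBetti.map ι.ι 2 a + complexBetti.map ψ₀.hom.hom.hom 2 (complexBetti.map ι.ι 2 a)) w)
    (A : AbelianVariety ℂ) (φ : A ⟶ A) (hA : A.dim = 2 * n) (hφ : φ ≫ φ = -(d • 𝟙 A))
    (eA : ProjectiveEmbedding A.X) (aA : complexBetti (projectiveSpace eA.n ℂ) 2) (haA : IsRationalClass aA)
    (haA0 : aA ≠ 0)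
    (hhypA : IsHyperbolicWeilType A φ n
      ((d : ℂ) • complexBetti.map eA.ι 2 aA + complexBetti.map φ.hom.hom.hom 2 (complexBetti.map eA.ι 2 aA))) :
    weilClassesOf A φ n d ≤ algebraicClasses A.X n :=
  weilClasses_algebraic_hyperbolic_of_localAnchor n d hn hd
    ((hasLocallyAlgebraicWeilAnchor_iff n d).2
      ⟨P, ψ₀, ι, a, w, hP, hψ, ha, ha0, hhyp, hwW, hwr, hw0, weilAnchorLocalClause_of_BF_of_sheafSeedAt d C hBF hS⟩)
    hF A φ hA hφ eA aA haA haA0 hhypA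

end Summit.Ventures.HSemireg

end
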